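import Summits.BirchSwinnertonDyer.BirchSwinnertonDyer.Theorems.GenusKolyvaginAtTwoEquivariantKolyvaginExactAtTwoCebotarevVisibleRat
import Summits.BirchSwinnertonDyer.BirchSwinnertonDyer.Theorems.ByReductionTypeAtTwoRankOneAtTwoBigImageOddLocalOneDoorBottomNoInflationDefect
import Summits.BirchSwinnertonDyer.BirchSwinnertonDyer.Theorems.GenusKolyvaginAtTwoEquivariantChebotarevAtTwoOffDiscField
import Literature.NumberTheory.EllipticCurves.BSDRankZeroDensity
import HarnessLib

/-!
# Route ByReductionTypeAtTwo, crux `RankOneAtTwoBigImageOddLocal` (stmt-BirchSwinnertonDyer-23715), LINE v8.9 `one_door_analytic`: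
# the ČEBOTAREV leaves `ceb₁`, `ceb₂`, `ceb₂'` of `FirstDescentInput` from route GenusKolyvaginAtTwo's VISIBLE Čebotarev at `2`

Width prover seat `bsd-line-fkl-p2` g10 (2026-08-28), `--supports stmt-BirchSwinnertonDyer-23715` (helper).  THEOREMS ONLY (no
definition, no named fact, no `sorry`).  BSD is not proved by any of this.

The lead's input record `FirstDescentInput W Wd` (`…OneDoorFirstDescentDefs.lean`, p641630) asks, at `M = 2`, for Kolyvagin primes at
whose place prescribed classes do NOT vanish: `ceb₁` (the Heegner class `y` alone), `ceb₂` (an E-side pair `s ∉ {0, y}`), `ceb₂'` (a cross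
pair: `s' ∈ H¹(ℚ, Wd[2])` and `y`).  Route GenusKolyvaginAtTwo PROVED the visible Čebotarev at `2` over `ℚ` for PURE families of the pair
`(E, E^{(d_K)})` (`GenusExact.SelmerDescent.cebotarev_visible_rat_of_not_isSquare`, gk2-p2 g11, from 27280) under the VISIBILITY
hypothesis `hvis`: independence of the family after restriction to `K` and pairing with `Γ_{K(E[2])}`.  At `M = 1` that hypothesis is
DISCHARGED by the injectivity of `H¹(K, E_K[2]) → Hom(Γ_{K(E[2])}, E[2])` (no inflation defect at level `2`,
`…OneDoorBottomNoInflationDefect.lean`: `eq_zero_of_forall_h1Eval_two_eq_zero_of_surjective` for `W.baseChange K`, whose mod-`2` image is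
onto by Dokchitser–Dokchitser (1): no `K`-rational `2`-torsion and `Δ ∉ K^{×2}` — §0, `hinjK_of_habitat`) — kept as an explicit hypothesis
`hinjK` in §§2–3 and discharged in §4 — together with the injectivity of `res : H¹(ℚ, ·[2]) →
H¹(K, E_K[2])` on both members (`EigenClassesFinite.resTorsion(_twist)_injective_of_noTorsion`, `E(K)[2] = 0` from `ρ̄_{E,2}` onto) and
`𝔽₂`-independence of two distinct non-zero `2`-torsion classes.

* §0 `hasSurjectiveModNGaloisRep_two_baseChange_of_not_isSquare`, `hinjK_of_not_isSquare`, `hinjK_of_habitat` — no inflation defect at level `2` over the door field `K`;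
* §1 `zsmul_eq_zero_and_of_pair` — fact-free: `2s = 2y = 0`, `s, y ≠ 0`, `s ≠ y`, `a₀ s + a₁ y = 0 ⟹ a₀ s = 0 ∧ a₁ y = 0`;
* §2 `ceb₂_rat` — E-side pair: for `s, y ∈ H¹(ℚ, W[2])`, `s, y ≠ 0`, `s ≠ y` and every bound `b`, a Gross–Kolyvagin prime `ℓ > b`
  (`FrobEqFrobInfty W K 2 ℓ`, `Zhang2014.IsKolyvaginPrime N W K 2 ℓ`, index `≥ 1`) with `s, y ∉ torsionLocalKer_v(W)` at `v ∋ ℓ`;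
  `ceb₁_rat` — the single class `y`;
* §3 `ceb₂'_rat` — cross pair: `s' ∈ H¹(ℚ, W^{(d_K)}[2])`, `y ∈ H¹(ℚ, W[2])` with DISTINCT restrictions `hPsiKT (res s') ≠ res y`
  (the «twin copy of `y`» is the lead's `hceb₂_of_visible₂` case, served by `ceb₁`);
(The versions with `hinjK` DISCHARGED by §0 — unconditional on the habitat — are the sibling `…OneDoorBottomCebotarevHabitat.lean`.)

References: [McCallumLMS1991] §3 Cor. 3.2; [GrossLMS1991] Prop. 9.1, §10; [Kolyvagin1989Izv] §3; [LawsonWuthrich2016] §7.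
-/

set_option autoImplicit false
-- the Theorems namespace of this sub repeats the summit name by design (D-0017 nested layout)
set_option linter.dupNamespace false

noncomputable section

open scoped Classical

namespace Summit.BirchSwinnertonDyer.BirchSwinnertonDyer.Theorems.RankOneAtTwoOneDoor

open WeierstrassCurve NumberField IsDedekindDomain Field Finset
open Literature.NumberTheory.EllipticCurves Literature.NumberTheory.GaloisRepresentations
open Summit.BirchSwinnertonDyer.BirchSwinnertonDyer.Theorems.GenusExact
open Summit.BirchSwinnertonDyer.BirchSwinnertonDyer.Theorems.GenusExact.EigenClassesFinite
open Summit.BirchSwinnertonDyer.BirchSwinnertonDyer.Theorems.GenusExact.SelmerDescent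
open Literature.NumberTheory.EllipticCurves.DokchitserDokchitser2012

/-! ## §0 No inflation defect at level `2` over the door field `K` -/

section OverK

variable (W : WeierstrassCurve ℚ) [W.IsElliptic] (K : Type) [Field K] [NumberField K]

/-- **`ρ̄_{E_K,2}` is onto over the quadratic field `K`** when `ρ̄_{E,2}` is onto over `ℚ` and `d_K · Δ ∉ ℚ^{×2}`: no `K`-rational point of
order `2` (a cubic irreducible over `ℚ` has no root in a quadratic field) and `Δ ∉ K^{×2}`; Dokchitser–Dokchitser (1).
[cite: DokchitserDokchitserMathZ2012, Theorem (1)] -/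
theorem hasSurjectiveModNGaloisRep_two_baseChange_of_not_isSquare (hK2 : Module.finrank ℚ K = 2)
    (hs : W.HasSurjectiveModNGaloisRep 2) (hns : ¬ IsSquare ((NumberField.discr K : ℚ) * W.Δ)) :
    (W.baseChange K).HasSurjectiveModNGaloisRep 2 := by
  haveI : (W.baseChange K).IsElliptic := inferInstanceAs (W.map (algebraMap ℚ K)).IsElliptic
  refine hasSurjectiveModNGaloisRep_two_of (W.baseChange K) two_ne_zero (fun P hP => ?_)
    (not_isSquare_baseChange_Δ_of_not_isSquare W K hK2 hs hns)
  exact forall_two_nsmul_baseChange_of_hasSurjectiveModNGaloisRep_two_of_finrank_eq_two W hs K hK2 P hP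

/-- **The displayed input `hinjK` of the Čebotarev leaves, DISCHARGED**: over the door field `K` (quadratic, `d_K · Δ ∉ ℚ^{×2}`) with
`ρ̄_{W,2}` onto, a class `x ∈ H¹(K, E_K[2])` with `[x, ρ] = 0` for all `ρ ∈ Γ_{K(E[2])}` is zero. [cite: GrossLMS1991, Prop. 9.1] -/
theorem hinjK_of_not_isSquare (hK2 : Module.finrank ℚ K = 2)
    (hs : W.HasSurjectiveModNGaloisRep 2) (hns : ¬ IsSquare ((NumberField.discr K : ℚ) * W.Δ)) :
    ∀ x : galH1Torsion (W.baseChange K) ((2 : ℕ) : ℤ),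
      (∀ ρ ∈ torsionFixing (W.baseChange K) ((2 : ℕ) : ℤ), h1Eval (W.baseChange K) ((2 : ℕ) : ℤ) x ρ = 0) → x = 0 := by
  haveI : (W.baseChange K).IsElliptic := inferInstanceAs (W.map (algebraMap ℚ K)).IsElliptic
  intro x hx
  exact eq_zero_of_forall_h1Eval_two_eq_zero_of_surjective (W.baseChange K)
    (hasSurjectiveModNGaloisRep_two_baseChange_of_not_isSquare W K hK2 hs hns) hx

/-- **`hinjK` on gk2's LINE-6 habitat / the `Δ_W < 0` corner of the bottom rung** (binders `ρ_{W,2^n}` onto for all `n`, `Δ_W < 0`,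
`¬ IsSquare (d_K · (−|Δ_W|))`, `K` imaginary quadratic). [cite: GrossLMS1991, Prop. 9.1] -/
theorem hinjK_of_habitat (hK : IsImaginaryQuadratic K) (hΔ : W.Δ < 0)
    (hρ : ∀ n : ℕ, W.HasSurjectiveModNGaloisRep (2 ^ n : ℕ)) (hns : ¬ IsSquare ((NumberField.discr K : ℚ) * -|W.Δ|)) :
    ∀ x : galH1Torsion (W.baseChange K) ((2 : ℕ) : ℤ),
      (∀ ρ ∈ torsionFixing (W.baseChange K) ((2 : ℕ) : ℤ), h1Eval (W.baseChange K) ((2 : ℕ) : ℤ) x ρ = 0) → x = 0 := by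
  have hρ2 : W.HasSurjectiveModNGaloisRep 2 := by simpa using hρ 1
  have habs : -|W.Δ| = W.Δ := by rw [abs_of_neg hΔ, neg_neg]
  rw [habs] at hns
  exact hinjK_of_not_isSquare W K hK.1 hρ2 hns

end OverK

/-! ## §1 Two distinct non-zero `2`-torsion elements are `𝔽₂`-independent -/

/-- An integer multiple of a `2`-torsion element is `0` or the element. [folklore] -/
theorem zsmul_eq_zero_or_eq_of_two_zsmul {V : Type*} [AddCommGroup V] {s : V} (h2 : (2 : ℤ) • s = 0) (a : ℤ) :
    a • s = 0 ∨ a • s = s := by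
  rcases Int.emod_two_eq_zero_or_one a with h | h
  · left
    obtain ⟨k, hk⟩ : ∃ k, a = 2 * k := ⟨a / 2, by omega⟩
    rw [hk, mul_comm, mul_zsmul, h2, zsmul_zero]
  · right
    obtain ⟨k, hk⟩ : ∃ k, a = 2 * k + 1 := ⟨a / 2, by omega⟩
    rw [hk, add_zsmul, one_zsmul, mul_comm, mul_zsmul, h2, zsmul_zero, zero_add]

/-- **Fact-free**: if `2s = 2y = 0`, `s ≠ 0`, `y ≠ 0`, `s ≠ y` and `a₀ s + a₁ y = 0` then `a₀ s = 0` and `a₁ y = 0` (`{s, y}` is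
`𝔽₂`-independent). [folklore] -/
theorem zsmul_eq_zero_and_of_pair {V : Type*} [AddCommGroup V] {s y : V} (h2s : (2 : ℤ) • s = 0) (h2y : (2 : ℤ) • y = 0)
    (hs0 : s ≠ 0) (hy0 : y ≠ 0) (hsy : s ≠ y) {a₀ a₁ : ℤ} (h : a₀ • s + a₁ • y = 0) : a₀ • s = 0 ∧ a₁ • y = 0 := by
  rcases zsmul_eq_zero_or_eq_of_two_zsmul h2s a₀ with h₀ | h₀ <;> rcases zsmul_eq_zero_or_eq_of_two_zsmul h2y a₁ with h₁ | h₁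
  · exact ⟨h₀, h₁⟩
  · rw [h₀, h₁, zero_add] at h; exact absurd h hy0
  · rw [h₀, h₁, add_zero] at h; exact absurd h hs0
  · exfalso
    rw [h₀, h₁] at h
    apply hsy
    have hy2 : y + y = 0 := by rw [← two_zsmul]; exact_mod_cast h2y
    calc s = s + y + y := by rw [add_assoc, hy2, add_zero]
      _ = y := by rw [h, zero_add]

/-! ## §2 The E-side leaves `ceb₂`, `ceb₁` -/

section Rat

variable (N : ℕ) [NeZero N] (W : WeierstrassCurve ℚ) [W.IsElliptic] [W.IsGloballyMinimal]
  {K : Type} [Field K] [NumberField K]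

/-- **`ceb₂` over `ℚ` — Čebotarev at `M = 2` for an E-side PAIR.**  On gk2's LINE-6 habitat (`W` globally minimal, non-CM, `Δ_W < 0`,
`ρ_{W,2^n}` onto for all `n`; `K = ℚ(θ)` imaginary quadratic, `θ² = d_K` odd, `¬ IsSquare (d_K · (−|Δ_W|))`; `N_W ∣ N`), granted the
injectivity `hinjK` of `H¹(K, E_K[2]) → Hom(Γ_{K(E[2])}, E[2])` (no inflation defect at level `2`; a tree theorem for this habitat,
`…OneDoorBottomNoInflationDefect`): for `s, y ∈ H¹(ℚ, W[2])` non-zero and distinct and every bound `b` there is a Gross–Kolyvagin prime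
`ℓ > b` (`Frob_ℓ ∼ Frob_∞` on `K(E[2])`, Zhang–Kolyvagin at `2` of level `N`, index `≥ 1`) at whose place NEITHER `s` NOR `y` vanishes.
Proof: `cebotarev_visible_rat_of_not_isSquare` for the pure family `((s,0),(y,0))` with `Nv = (1,1)`; its visibility hypothesis follows
from `hinjK`, the injectivity of `res` (`resTorsion_injective_of_noTorsion`, `E(K)[2] = 0`) and §1.
[cite: McCallumLMS1991, §3 Cor. 3.2] [cite: GrossLMS1991, Prop. 9.1 and §10] -/
theorem ceb₂_rat (hN : W.conductorNorm ℤ ∣ N) (hcm : ¬ W.HasCM) (hΔ : W.Δ < 0) (hK : IsImaginaryQuadratic K)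
    (hodd : Odd (NumberField.discr K)) (hns : ¬ IsSquare ((NumberField.discr K : ℚ) * -|W.Δ|))
    (hρ : ∀ n : ℕ, W.HasSurjectiveModNGaloisRep (2 ^ n : ℕ))
    {θ : K} (hθ : θ ∉ Set.range (algebraMap ℚ K)) (hc : θ ^ 2 = algebraMap ℚ K ((NumberField.discr K : ℤ) : ℚ))
    (hinjK : ∀ x : galH1Torsion (W.baseChange K) ((2 : ℕ) : ℤ),
      (∀ ρ ∈ torsionFixing (W.baseChange K) ((2 : ℕ) : ℤ), h1Eval (W.baseChange K) ((2 : ℕ) : ℤ) x ρ = 0) → x = 0)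
    (s y : galH1Torsion W ((2 : ℕ) : ℤ)) (hs0 : s ≠ 0) (hy0 : y ≠ 0) (hsy : s ≠ y) (b : ℕ) :
    ∃ ℓ : ℕ, b < ℓ ∧ FrobEqFrobInfty W K 2 ℓ ∧ Zhang2014.IsKolyvaginPrime N W K 2 ℓ ∧ 1 ≤ Zhang2014.kolyvaginIndex W 2 ℓ ∧
      ∀ v : HeightOneSpectrum (𝓞 ℚ), (ℓ : 𝓞 ℚ) ∈ v.asIdeal →
        s ∉ W.torsionLocalKer (v.adicCompletion ℚ) ((2 : ℕ) : ℤ) ∧ y ∉ W.torsionLocalKer (v.adicCompletion ℚ) ((2 : ℕ) : ℤ) := by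
  have h2K : Module.finrank ℚ K = 2 := hK.1
  have hD0 : ((NumberField.discr K : ℤ) : ℚ) ≠ 0 := by exact_mod_cast NumberField.discr_ne_zero K
  haveI : (W.quadraticTwist ((NumberField.discr K : ℤ) : ℚ)).IsElliptic := W.isElliptic_quadraticTwist hD0
  have hρ2 : W.HasSurjectiveModNGaloisRep 2 := by simpa using hρ 1
  have hL : ∀ P : (W.baseChange K).toAffine.Point, (((2 : ℕ) : ℤ)) • P = 0 → P = 0 := by
    intro P hP
    refine forall_zsmul_two_pow_baseChange_eq_zero_of_hasSurjectiveModNGaloisRep_two W K h2K hρ2 1 P ?_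
    simpa using hP
  have hresinj : Function.Injective (resTorsion W K (((2 : ℕ) : ℤ))) := resTorsion_injective_of_noTorsion W K h2K hθ hc _ hL
  set cs : Fin 2 → galH1Torsion W (((2 : ℕ) : ℤ)) × galH1Torsion (W.quadraticTwist ((NumberField.discr K : ℤ) : ℚ)) (((2 : ℕ) : ℤ)) :=
    ![(s, 0), (y, 0)] with hcs
  have hcs0 : cs 0 = (s, 0) := rfl
  have hcs1 : cs 1 = (y, 0) := rfl
  have h0 : ∀ i, cs i ≠ 0 := by
    intro i; fin_cases i
    · exact fun h => hs0 (congrArg Prod.fst h)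
    · exact fun h => hy0 (congrArg Prod.fst h)
  have hNv : ∀ i : Fin 2, (fun _ => 1 : Fin 2 → ℕ) i ≠ 0 → ((2 : ℤ) ^ ((fun _ => 1 : Fin 2 → ℕ) i - 1)) • cs i ≠ 0 := by
    intro i _; simpa using h0 i
  have hpure : ∀ i, (cs i).2 = 0 ∨ (cs i).1 = 0 := by
    intro i; fin_cases i <;> exact Or.inl rfl
  have h2s : (2 : ℤ) • s = 0 := by exact_mod_cast zsmul_galH1Torsion_eq_zero W (((2 : ℕ) : ℤ)) s
  have h2y : (2 : ℤ) • y = 0 := by exact_mod_cast zsmul_galH1Torsion_eq_zero W (((2 : ℕ) : ℤ)) y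
  have hvis : ∀ a : Fin 2 → ℤ, (∀ ρ ∈ torsionFixing (W.baseChange K) (((2 : ℕ) : ℤ)),
      h1Eval (W.baseChange K) (((2 : ℕ) : ℤ)) (∑ i, a i • (resTorsion W K (((2 : ℕ) : ℤ)) (cs i).1 +
        hPsiKT W K hθ hc (((2 : ℕ) : ℤ))
          (resTorsion (W.quadraticTwist ((NumberField.discr K : ℤ) : ℚ)) K (((2 : ℕ) : ℤ)) (cs i).2))) ρ = 0) →
      ∀ i, a i • cs i = 0 := by
    intro a ha
    have hsum : ∑ i, a i • (resTorsion W K (((2 : ℕ) : ℤ)) (cs i).1 +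
        hPsiKT W K hθ hc (((2 : ℕ) : ℤ))
          (resTorsion (W.quadraticTwist ((NumberField.discr K : ℤ) : ℚ)) K (((2 : ℕ) : ℤ)) (cs i).2)) =
        resTorsion W K (((2 : ℕ) : ℤ)) (a 0 • s + a 1 • y) := by
      rw [Fin.sum_univ_two, hcs0, hcs1]
      simp only [map_zero, add_zero, map_add, map_zsmul]
    have hzero : resTorsion W K (((2 : ℕ) : ℤ)) (a 0 • s + a 1 • y) = 0 := by
      rw [← hsum]; exact hinjK _ ha
    have hrel : a 0 • s + a 1 • y = 0 := hresinj (by rw [hzero, map_zero])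
    obtain ⟨ha0, ha1⟩ := zsmul_eq_zero_and_of_pair h2s h2y hs0 hy0 hsy hrel
    intro i; fin_cases i
    · show a 0 • cs 0 = 0
      rw [hcs0, Prod.smul_mk, ha0, zsmul_zero]; rfl
    · show a 1 • cs 1 = 0
      rw [hcs1, Prod.smul_mk, ha1, zsmul_zero]; rfl
  obtain ⟨ℓ, hbℓ, hFrob, hKol, hM, hloc⟩ :=
    cebotarev_visible_rat_of_not_isSquare N W hN hcm hΔ K hK hodd hns hρ hθ hc 1 le_rfl (q := 2) (pow_one 2).symm 2 cs
      (fun _ => 1) h0 hNv hpure hvis b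
  refine ⟨ℓ, hbℓ, hFrob, hKol, hM, fun v hv => ?_⟩
  have hzero₂ : (0 : galH1Torsion (W.quadraticTwist ((NumberField.discr K : ℤ) : ℚ)) (((2 : ℕ) : ℤ))) ∈
      (W.quadraticTwist ((NumberField.discr K : ℤ) : ℚ)).torsionLocalKer (v.adicCompletion ℚ) (((2 : ℕ) : ℤ)) :=
    AddSubgroup.zero_mem _
  constructor
  · intro hs
    have h := (hloc 0 v hv 0).mp (by simp only [hcs0, pow_zero, one_smul]; exact ⟨hs, hzero₂⟩)
    omega
  · intro hy
    have h := (hloc 1 v hv 0).mp (by simp only [hcs1, pow_zero, one_smul]; exact ⟨hy, hzero₂⟩)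
    omega

/-- **`ceb₁` over `ℚ` — a Kolyvagin prime at which ONE non-zero class `y ∈ H¹(ℚ, W[2])` does not vanish** (same habitat and
`hinjK`; the family `((y, 0))`). [cite: McCallumLMS1991, §3 Cor. 3.2] [cite: GrossLMS1991, §10] -/
theorem ceb₁_rat (hN : W.conductorNorm ℤ ∣ N) (hcm : ¬ W.HasCM) (hΔ : W.Δ < 0) (hK : IsImaginaryQuadratic K)
    (hodd : Odd (NumberField.discr K)) (hns : ¬ IsSquare ((NumberField.discr K : ℚ) * -|W.Δ|))
    (hρ : ∀ n : ℕ, W.HasSurjectiveModNGaloisRep (2 ^ n : ℕ))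
    {θ : K} (hθ : θ ∉ Set.range (algebraMap ℚ K)) (hc : θ ^ 2 = algebraMap ℚ K ((NumberField.discr K : ℤ) : ℚ))
    (hinjK : ∀ x : galH1Torsion (W.baseChange K) ((2 : ℕ) : ℤ),
      (∀ ρ ∈ torsionFixing (W.baseChange K) ((2 : ℕ) : ℤ), h1Eval (W.baseChange K) ((2 : ℕ) : ℤ) x ρ = 0) → x = 0)
    (y : galH1Torsion W ((2 : ℕ) : ℤ)) (hy0 : y ≠ 0) (b : ℕ) :
    ∃ ℓ : ℕ, b < ℓ ∧ FrobEqFrobInfty W K 2 ℓ ∧ Zhang2014.IsKolyvaginPrime N W K 2 ℓ ∧ 1 ≤ Zhang2014.kolyvaginIndex W 2 ℓ ∧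
      ∀ v : HeightOneSpectrum (𝓞 ℚ), (ℓ : 𝓞 ℚ) ∈ v.asIdeal → y ∉ W.torsionLocalKer (v.adicCompletion ℚ) ((2 : ℕ) : ℤ) := by
  have h2K : Module.finrank ℚ K = 2 := hK.1
  have hD0 : ((NumberField.discr K : ℤ) : ℚ) ≠ 0 := by exact_mod_cast NumberField.discr_ne_zero K
  haveI : (W.quadraticTwist ((NumberField.discr K : ℤ) : ℚ)).IsElliptic := W.isElliptic_quadraticTwist hD0
  have hρ2 : W.HasSurjectiveModNGaloisRep 2 := by simpa using hρ 1
  have hL : ∀ P : (W.baseChange K).toAffine.Point, (((2 : ℕ) : ℤ)) • P = 0 → P = 0 := by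
    intro P hP
    refine forall_zsmul_two_pow_baseChange_eq_zero_of_hasSurjectiveModNGaloisRep_two W K h2K hρ2 1 P ?_
    simpa using hP
  have hresinj : Function.Injective (resTorsion W K (((2 : ℕ) : ℤ))) := resTorsion_injective_of_noTorsion W K h2K hθ hc _ hL
  set cs : Fin 1 → galH1Torsion W (((2 : ℕ) : ℤ)) × galH1Torsion (W.quadraticTwist ((NumberField.discr K : ℤ) : ℚ)) (((2 : ℕ) : ℤ)) :=
    ![(y, 0)] with hcs
  have hcs0 : cs 0 = (y, 0) := rfl
  have h0 : ∀ i, cs i ≠ 0 := by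
    intro i; fin_cases i
    exact fun h => hy0 (congrArg Prod.fst h)
  have hNv : ∀ i : Fin 1, (fun _ => 1 : Fin 1 → ℕ) i ≠ 0 → ((2 : ℤ) ^ ((fun _ => 1 : Fin 1 → ℕ) i - 1)) • cs i ≠ 0 := by
    intro i _; simpa using h0 i
  have hpure : ∀ i, (cs i).2 = 0 ∨ (cs i).1 = 0 := by
    intro i; fin_cases i; exact Or.inl rfl
  have hvis : ∀ a : Fin 1 → ℤ, (∀ ρ ∈ torsionFixing (W.baseChange K) (((2 : ℕ) : ℤ)),
      h1Eval (W.baseChange K) (((2 : ℕ) : ℤ)) (∑ i, a i • (resTorsion W K (((2 : ℕ) : ℤ)) (cs i).1 +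
        hPsiKT W K hθ hc (((2 : ℕ) : ℤ))
          (resTorsion (W.quadraticTwist ((NumberField.discr K : ℤ) : ℚ)) K (((2 : ℕ) : ℤ)) (cs i).2))) ρ = 0) →
      ∀ i, a i • cs i = 0 := by
    intro a ha
    have hsum : ∑ i, a i • (resTorsion W K (((2 : ℕ) : ℤ)) (cs i).1 +
        hPsiKT W K hθ hc (((2 : ℕ) : ℤ))
          (resTorsion (W.quadraticTwist ((NumberField.discr K : ℤ) : ℚ)) K (((2 : ℕ) : ℤ)) (cs i).2)) =
        resTorsion W K (((2 : ℕ) : ℤ)) (a 0 • y) := by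
      rw [Fin.sum_univ_one, hcs0]
      simp only [map_zero, add_zero, map_zsmul]
    have hzero : resTorsion W K (((2 : ℕ) : ℤ)) (a 0 • y) = 0 := by
      rw [← hsum]; exact hinjK _ ha
    have hrel : a 0 • y = 0 := hresinj (by rw [hzero, map_zero])
    intro i; fin_cases i
    show a 0 • cs 0 = 0
    rw [hcs0, Prod.smul_mk, hrel, zsmul_zero]; rfl
  obtain ⟨ℓ, hbℓ, hFrob, hKol, hM, hloc⟩ :=
    cebotarev_visible_rat_of_not_isSquare N W hN hcm hΔ K hK hodd hns hρ hθ hc 1 le_rfl (q := 2) (pow_one 2).symm 1 cs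
      (fun _ => 1) h0 hNv hpure hvis b
  refine ⟨ℓ, hbℓ, hFrob, hKol, hM, fun v hv hy => ?_⟩
  have hzero₂ : (0 : galH1Torsion (W.quadraticTwist ((NumberField.discr K : ℤ) : ℚ)) (((2 : ℕ) : ℤ))) ∈
      (W.quadraticTwist ((NumberField.discr K : ℤ) : ℚ)).torsionLocalKer (v.adicCompletion ℚ) (((2 : ℕ) : ℤ)) :=
    AddSubgroup.zero_mem _
  have h := (hloc 0 v hv 0).mp (by simp only [hcs0, pow_zero, one_smul]; exact ⟨hy, hzero₂⟩)
  omega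

/-! ## §3 The cross leaf `ceb₂'` -/

/-- **`ceb₂'` over `ℚ` — Čebotarev at `M = 2` for a CROSS PAIR**: `s' ∈ H¹(ℚ, W^{(d_K)}[2])` non-zero, `y ∈ H¹(ℚ, W[2])` non-zero, with
DISTINCT restrictions to `K` (`hPsiKT (res s') ≠ res y` — the «twin copy of `y`» is excluded; it is served by `ceb₁` through the lead's
`hceb₂_of_visible₂`).  Same habitat and `hinjK`; the pure family `((0, s'), (y, 0))` with `Nv = (1,1)`; its visibility from `hinjK`, the
injectivity of both restrictions (`resTorsion_injective_of_noTorsion`, `resTorsion_twist_injective_of_noTorsion`) and §1 applied in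
`H¹(K, E_K[2])`.  Conclusion: a Gross–Kolyvagin prime `ℓ > b` with `s' ∉ torsionLocalKer_v(W^{(d_K)})` and `y ∉ torsionLocalKer_v(W)` at
`v ∋ ℓ`. [cite: McCallumLMS1991, §3 Cor. 3.2 and p. 299] [cite: Kolyvagin1989Izv, §3] -/
theorem ceb₂'_rat (hN : W.conductorNorm ℤ ∣ N) (hcm : ¬ W.HasCM) (hΔ : W.Δ < 0) (hK : IsImaginaryQuadratic K)
    (hodd : Odd (NumberField.discr K)) (hns : ¬ IsSquare ((NumberField.discr K : ℚ) * -|W.Δ|))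
    (hρ : ∀ n : ℕ, W.HasSurjectiveModNGaloisRep (2 ^ n : ℕ))
    {θ : K} (hθ : θ ∉ Set.range (algebraMap ℚ K)) (hc : θ ^ 2 = algebraMap ℚ K ((NumberField.discr K : ℤ) : ℚ))
    [(W.quadraticTwist ((NumberField.discr K : ℤ) : ℚ)).IsElliptic]
    (hinjK : ∀ x : galH1Torsion (W.baseChange K) ((2 : ℕ) : ℤ),
      (∀ ρ ∈ torsionFixing (W.baseChange K) ((2 : ℕ) : ℤ), h1Eval (W.baseChange K) ((2 : ℕ) : ℤ) x ρ = 0) → x = 0)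
    (s' : galH1Torsion (W.quadraticTwist ((NumberField.discr K : ℤ) : ℚ)) ((2 : ℕ) : ℤ)) (y : galH1Torsion W ((2 : ℕ) : ℤ))
    (hs0 : s' ≠ 0) (hy0 : y ≠ 0)
    (hne : hPsiKT W K hθ hc ((2 : ℕ) : ℤ) (resTorsion (W.quadraticTwist ((NumberField.discr K : ℤ) : ℚ)) K ((2 : ℕ) : ℤ) s') ≠
      resTorsion W K ((2 : ℕ) : ℤ) y)
    (b : ℕ) :
    ∃ ℓ : ℕ, b < ℓ ∧ FrobEqFrobInfty W K 2 ℓ ∧ Zhang2014.IsKolyvaginPrime N W K 2 ℓ ∧ 1 ≤ Zhang2014.kolyvaginIndex W 2 ℓ ∧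
      ∀ v : HeightOneSpectrum (𝓞 ℚ), (ℓ : 𝓞 ℚ) ∈ v.asIdeal →
        s' ∉ (W.quadraticTwist ((NumberField.discr K : ℤ) : ℚ)).torsionLocalKer (v.adicCompletion ℚ) ((2 : ℕ) : ℤ) ∧
          y ∉ W.torsionLocalKer (v.adicCompletion ℚ) ((2 : ℕ) : ℤ) := by
  have h2K : Module.finrank ℚ K = 2 := hK.1
  have hρ2 : W.HasSurjectiveModNGaloisRep 2 := by simpa using hρ 1
  have hL : ∀ P : (W.baseChange K).toAffine.Point, (((2 : ℕ) : ℤ)) • P = 0 → P = 0 := by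
    intro P hP
    refine forall_zsmul_two_pow_baseChange_eq_zero_of_hasSurjectiveModNGaloisRep_two W K h2K hρ2 1 P ?_
    simpa using hP
  have hresinj : Function.Injective (resTorsion W K (((2 : ℕ) : ℤ))) := resTorsion_injective_of_noTorsion W K h2K hθ hc _ hL
  have hresinj' : Function.Injective (resTorsion (W.quadraticTwist ((NumberField.discr K : ℤ) : ℚ)) K (((2 : ℕ) : ℤ))) :=
    resTorsion_twist_injective_of_noTorsion W K h2K hθ hc _ hL
  set u := hPsiKT W K hθ hc ((2 : ℕ) : ℤ) (resTorsion (W.quadraticTwist ((NumberField.discr K : ℤ) : ℚ)) K ((2 : ℕ) : ℤ) s') with hu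
  set w := resTorsion W K ((2 : ℕ) : ℤ) y with hw
  have hu0 : u ≠ 0 := by
    intro h
    apply hs0
    apply hresinj'
    rw [map_zero]
    exact (hPsiKT W K hθ hc ((2 : ℕ) : ℤ)).injective (by rw [← hu, h, map_zero])
  have hw0 : w ≠ 0 := fun h => hy0 (hresinj (by rw [← hw, h, map_zero]))
  have h2u : (2 : ℤ) • u = 0 := by exact_mod_cast zsmul_galH1Torsion_eq_zero (W.baseChange K) (((2 : ℕ) : ℤ)) u
  have h2w : (2 : ℤ) • w = 0 := by exact_mod_cast zsmul_galH1Torsion_eq_zero (W.baseChange K) (((2 : ℕ) : ℤ)) w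
  set cs : Fin 2 → galH1Torsion W (((2 : ℕ) : ℤ)) × galH1Torsion (W.quadraticTwist ((NumberField.discr K : ℤ) : ℚ)) (((2 : ℕ) : ℤ)) :=
    ![(0, s'), (y, 0)] with hcs
  have hcs0 : cs 0 = (0, s') := rfl
  have hcs1 : cs 1 = (y, 0) := rfl
  have h0 : ∀ i, cs i ≠ 0 := by
    intro i; fin_cases i
    · exact fun h => hs0 (congrArg Prod.snd h)
    · exact fun h => hy0 (congrArg Prod.fst h)
  have hNv : ∀ i : Fin 2, (fun _ => 1 : Fin 2 → ℕ) i ≠ 0 → ((2 : ℤ) ^ ((fun _ => 1 : Fin 2 → ℕ) i - 1)) • cs i ≠ 0 := by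
    intro i _; simpa using h0 i
  have hpure : ∀ i, (cs i).2 = 0 ∨ (cs i).1 = 0 := by
    intro i; fin_cases i
    · exact Or.inr rfl
    · exact Or.inl rfl
  have hvis : ∀ a : Fin 2 → ℤ, (∀ ρ ∈ torsionFixing (W.baseChange K) (((2 : ℕ) : ℤ)),
      h1Eval (W.baseChange K) (((2 : ℕ) : ℤ)) (∑ i, a i • (resTorsion W K (((2 : ℕ) : ℤ)) (cs i).1 +
        hPsiKT W K hθ hc (((2 : ℕ) : ℤ))
          (resTorsion (W.quadraticTwist ((NumberField.discr K : ℤ) : ℚ)) K (((2 : ℕ) : ℤ)) (cs i).2))) ρ = 0) →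
      ∀ i, a i • cs i = 0 := by
    intro a ha
    have hsum : ∑ i, a i • (resTorsion W K (((2 : ℕ) : ℤ)) (cs i).1 +
        hPsiKT W K hθ hc (((2 : ℕ) : ℤ))
          (resTorsion (W.quadraticTwist ((NumberField.discr K : ℤ) : ℚ)) K (((2 : ℕ) : ℤ)) (cs i).2)) =
        a 0 • u + a 1 • w := by
      rw [Fin.sum_univ_two, hcs0, hcs1]
      simp only [map_zero, add_zero, zero_add, hu, hw]
    have hzero : a 0 • u + a 1 • w = 0 := by rw [← hsum]; exact hinjK _ ha
    obtain ⟨ha0, ha1⟩ := zsmul_eq_zero_and_of_pair h2u h2w hu0 hw0 hne hzero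
    have ha0' : a 0 • s' = 0 := by
      apply hresinj'
      apply (hPsiKT W K hθ hc ((2 : ℕ) : ℤ)).injective
      rw [map_zsmul, map_zsmul, ← hu, ha0, map_zero, map_zero]
    have ha1' : a 1 • y = 0 := hresinj (by rw [map_zsmul, ← hw, ha1, map_zero])
    intro i; fin_cases i
    · show a 0 • cs 0 = 0
      rw [hcs0, Prod.smul_mk, ha0', zsmul_zero]; rfl
    · show a 1 • cs 1 = 0
      rw [hcs1, Prod.smul_mk, ha1', zsmul_zero]; rfl
  obtain ⟨ℓ, hbℓ, hFrob, hKol, hM, hloc⟩ :=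
    cebotarev_visible_rat_of_not_isSquare N W hN hcm hΔ K hK hodd hns hρ hθ hc 1 le_rfl (q := 2) (pow_one 2).symm 2 cs
      (fun _ => 1) h0 hNv hpure hvis b
  refine ⟨ℓ, hbℓ, hFrob, hKol, hM, fun v hv => ?_⟩
  have hzero₁ : (0 : galH1Torsion W (((2 : ℕ) : ℤ))) ∈ W.torsionLocalKer (v.adicCompletion ℚ) (((2 : ℕ) : ℤ)) := AddSubgroup.zero_mem _
  have hzero₂ : (0 : galH1Torsion (W.quadraticTwist ((NumberField.discr K : ℤ) : ℚ)) (((2 : ℕ) : ℤ))) ∈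
      (W.quadraticTwist ((NumberField.discr K : ℤ) : ℚ)).torsionLocalKer (v.adicCompletion ℚ) (((2 : ℕ) : ℤ)) :=
    AddSubgroup.zero_mem _
  constructor
  · intro hs
    have h := (hloc 0 v hv 0).mp (by simp only [hcs0, pow_zero, one_smul]; exact ⟨hzero₁, hs⟩)
    omega
  · intro hy
    have h := (hloc 1 v hv 0).mp (by simp only [hcs1, pow_zero, one_smul]; exact ⟨hy, hzero₂⟩)
    omega

end Rat

end Summit.BirchSwinnertonDyer.BirchSwinnertonDyer.Theorems.RankOneAtTwoOneDoor

end
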